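import Mathlib.Analysis.InnerProductSpace.LaxMilgram
import Mathlib.Analysis.InnerProductSpace.Dual
import Mathlib.Analysis.Normed.Ring.Units
import Literature.Analysis.OperatorTheory.FiniteRankCapacitance
import Literature.Analysis.OperatorTheory.GramPencilBound
import HarnessLib

/-!
# Inverting `coercive − finite rank − small` between an energy space and its dual, with the constants

`Literature/Analysis/OperatorTheory`; proofs-layer file (theorems only; no definitions, no named facts), in the
vocabulary of `FiniteRankCapacitance.lean` (`finiteRank f g`, `capMatrix`, `capInverse`) and
`GramPencilBound.lean`.  It types, ABSTRACTLY, the three linear steps by which an a-posteriori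
(Newton–Kantorovich / radii-polynomial) existence proof for a nonlinear map `G : E → E*` on a Hilbert
("energy") space `E` obtains the constant `K ≥ ‖DG(x̄)⁻¹‖_{E* → E}` when `DG(x̄) = B − Π_N P − Π_T P` splits
into a COERCIVE local part `B`, a FINITE-RANK part `Π_N P` and a SMALL remainder `Π_T P`:

**(C1) Lax–Milgram with the constant.**  A bounded bilinear form `B : E →L E →L ℝ` (equivalently an operator
`E → E*`) with `c‖u‖² ≤ B u u`, `c > 0`, has a two-sided bounded inverse `S : E* → E` with `‖S φ‖ ≤ c⁻¹‖φ‖`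
(`exists_inverse_of_coercive`; Mathlib's `IsCoercive.continuousLinearEquivOfBilin` composed with the Riesz map
`InnerProductSpace.toDual`) [cite: Brezis2011, Cor. 5.8 (Lax–Milgram)]; every approximate solution is enclosed
a posteriori, `‖S φ − ṽ‖ ≤ c⁻¹‖φ − B ṽ‖` (`norm_inverse_sub_le_of_residual`), and adjoint data transport
functionals through `S`: `B† z = ℓ ⇒ ℓ (S φ) = φ z` (`apply_inverse_eq_of_adjoint`).

**(C2) Finite-rank correction (Sherman–Morrison–Woodbury).**  For `D_N u := B u − ∑ᵢ ℓᵢ(u) fᵢ`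
(`fᵢ ∈ F`, `ℓᵢ ∈ E*`; here `F` is any normed space and `B : E → F` any operator with two-sided inverse `S`),
`D_N = (1 − finiteRank f (ℓ ∘ S)) ∘ B`, the capacitance matrix is `ℓⱼ(S fᵢ) = ℓⱼ(vᵢ)` (`vᵢ := S fᵢ`, the
"`N` forward solves"), and a two-sided inverse `N` of `1 − capMatrix` yields the two-sided inverse
`T_N y = S y + ∑ᵢ (N x)ᵢ vᵢ`, `xⱼ = ℓⱼ(S y)` (`finiteRankPerturbation_inverse`, `inverse_comp_capInverse_apply`)
[cite: Kato1966, III-§4.3, (4.13); IV-§1.4 Thm. 1.16].  With adjoint data `ℓⱼ(S y) = ⟪aⱼ, u(y)⟫` (from (C1):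
`aⱼ = zⱼ`, the "`N` adjoint solves", `u(y)` the Riesz representative of `y`, or `u = g` when `y = J g` comes
from a pivot Hilbert space `W`) the PRODUCT-FREE bound of `GramPencilBound.lean` gives
`‖T_N y‖ ≤ (K₁ + √Λ)‖u(y)‖` (`norm_inverse_add_correction_le`, `norm_inverse_add_correction_le_dual`).

**(C3) Small remainder in a weaker norm (two-norm Neumann step).**  If `D_N` has the two-sided inverse `T_N`
with `‖T_N y‖ ≤ K⋆‖y‖_F` and `‖T_N (J g)‖ ≤ K_w‖g‖_W` for an operator `J : W → F`, and `R : E → W` has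
`‖R u‖ ≤ ε‖u‖` with `K_w ε < 1`, then `D := D_N − J ∘ R` has a two-sided inverse with
`‖D⁻¹ y‖ ≤ K⋆/(1 − K_w ε) · ‖y‖_F` (`exists_inverse_sub_of_two_norm`) — the Banach lemma run in `E` on
`M = T_N J R`, `‖M‖ ≤ K_w ε` [cite: Kato1966, IV-§1.4, Thm. 1.16].

Everything is proved; nothing about a particular operator is asserted.  The fourth step (Newton–Kantorovich with
an exact inverse) is `Literature.Analysis.Calculus.existsUnique_zero_of_aposterioriValidation` /
`NewtonKantorovichExactInverse.lean`.

MOTIVATION (recorded for provenance): steps (C1)–(C3) of the certificate chain of cell ns-blowup, zone Z3, case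
Z3-SR-CERT (`HOME/profile/cert/impl1/SHEET-R-PRICE-impl1.md` §2, `PREREG-SHEET-R-CERT.md` P2/P4): `E = ` odd
`H¹_{L²+ξ²}`, `F = E* = X*`, `W = L²_w`, `B = B_λ` (coercive with `c_λ`), `fᵢ = eᵢ` the Cayley frame,
`ℓᵢ = ⟨P ·, eᵢ⟩_w/(2L³π)`, `K⋆ = K_N*`, `K_w = K_Nw`, `ε = ε_N`, `K = K_N*/(1 − K_Nw ε_N)`.  WHAT THIS IS NOT:
nothing about Navier–Stokes; abstract functional analysis.

## References
* [Brezis2011] H. Brezis, *Functional Analysis, Sobolev Spaces and Partial Differential Equations*, Springer 2011, Cor. 5.8.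
* [Kato1966] T. Kato, *Perturbation Theory for Linear Operators*, Springer 1966, III-§4.3 (4.13), IV-§1.4 Thm. 1.16.
-/

noncomputable section

open Matrix Finset
open scoped BigOperators

namespace Literature.Analysis.OperatorTheory

/-! ### (C1) Lax–Milgram with the constant; a-posteriori enclosure of local solves; adjoint transport -/

section Coercive

variable {E : Type*} [NormedAddCommGroup E] [InnerProductSpace ℝ E] [CompleteSpace E]

omit [CompleteSpace E] in
/-- The a-priori bound of a coercive form: `c‖u‖² ≤ B u u` gives `‖u‖ ≤ c⁻¹‖B u‖_{E*}`.
[cite: Brezis2011, Cor. 5.8 (Lax–Milgram), proof] -/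
theorem norm_le_of_coercive {B : E →L[ℝ] E →L[ℝ] ℝ} {c : ℝ} (hc : 0 < c)
    (hB : ∀ u, c * ‖u‖ ^ 2 ≤ B u u) (u : E) : ‖u‖ ≤ c⁻¹ * ‖B u‖ := by
  have h1 : B u u ≤ ‖B u‖ * ‖u‖ := (le_abs_self _).trans ((B u).le_opNorm u)
  have h2 : c * ‖u‖ ^ 2 ≤ ‖B u‖ * ‖u‖ := (hB u).trans h1
  by_cases hu : u = 0
  · subst hu; simp
  · have hpos : 0 < ‖u‖ := norm_pos_iff.2 hu
    rw [le_inv_mul_iff₀ hc]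
    nlinarith

/-- **Lax–Milgram with the constant.**  A bounded bilinear form `B` on a real Hilbert space with
`c‖u‖² ≤ B u u` (`c > 0`) — read as the operator `u ↦ B u : E → E*` — has a two-sided bounded inverse
`S : E* → E` with `‖S φ‖ ≤ c⁻¹‖φ‖`: for every `φ ∈ E*` the unique `v` with `B v = φ`.
[cite: Brezis2011, Cor. 5.8 (Lax–Milgram)] -/
theorem exists_inverse_of_coercive {B : E →L[ℝ] E →L[ℝ] ℝ} {c : ℝ} (hc : 0 < c)
    (hB : ∀ u, c * ‖u‖ ^ 2 ≤ B u u) :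
    ∃ S : StrongDual ℝ E →L[ℝ] E,
      (∀ φ, B (S φ) = φ) ∧ (∀ u, S (B u) = u) ∧ ∀ φ, ‖S φ‖ ≤ c⁻¹ * ‖φ‖ := by
  have hcoer : IsCoercive B := ⟨c, hc, fun u => by simpa [sq, mul_assoc] using hB u⟩
  set Φ := hcoer.continuousLinearEquivOfBilin with hΦ
  set R := InnerProductSpace.toDual ℝ E with hR
  -- the candidate inverse as a function
  set s : StrongDual ℝ E → E := fun φ => Φ.symm (R.symm φ) with hs
  have hBs : ∀ φ, B (s φ) = φ := by
    intro φ
    ext w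
    rw [hs]
    simp only
    rw [← IsCoercive.continuousLinearEquivOfBilin_apply hcoer, ContinuousLinearEquiv.apply_symm_apply,
      hR, InnerProductSpace.toDual_symm_apply]
  have hsB : ∀ u, s (B u) = u := by
    intro u
    have hRΦ : R (Φ u) = B u := by
      ext w
      rw [hR, InnerProductSpace.toDual_apply_apply, hΦ, IsCoercive.continuousLinearEquivOfBilin_apply]
    rw [hs]
    simp only
    rw [← hRΦ, LinearIsometryEquiv.symm_apply_apply, ContinuousLinearEquiv.symm_apply_apply]
  have hbound : ∀ φ, ‖s φ‖ ≤ c⁻¹ * ‖φ‖ := by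
    intro φ
    have h := norm_le_of_coercive hc hB (s φ)
    rwa [hBs] at h
  -- linearity
  set Sₗ : StrongDual ℝ E →ₗ[ℝ] E :=
    { toFun := s
      map_add' := fun φ ψ => by simp [hs, map_add]
      map_smul' := fun r φ => by simp [hs] } with hSₗ
  refine ⟨Sₗ.mkContinuous c⁻¹ (fun φ => hbound φ), fun φ => hBs φ, fun u => hsB u, fun φ => hbound φ⟩

/-- **A-posteriori enclosure of a local solve.**  If `S` is a left inverse of `B` with `‖S φ‖ ≤ K‖φ‖`, then
for ANY candidate `ṽ`: `‖S φ − ṽ‖ ≤ K‖φ − B ṽ‖` (the residual, measured in the dual norm, encloses the exact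
solve; with (C1), `K = c⁻¹`). [cite: Brezis2011, Cor. 5.8 (Lax–Milgram), proof (a-priori bound)] -/
theorem norm_inverse_sub_le_of_residual {E F : Type*} [NormedAddCommGroup E] [NormedSpace ℝ E]
    [NormedAddCommGroup F] [NormedSpace ℝ F] (B : E →L[ℝ] F) (S : F →L[ℝ] E)
    (hSB : ∀ u, S (B u) = u) {K : ℝ} (hS : ∀ φ, ‖S φ‖ ≤ K * ‖φ‖) (φ : F) (v : E) :
    ‖S φ - v‖ ≤ K * ‖φ - B v‖ := by
  have h : S φ - v = S (φ - B v) := by rw [map_sub, hSB]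
  rw [h]
  exact hS _

omit [CompleteSpace E] in
/-- **Adjoint transport.**  If `S` is a right inverse of the form-operator `B` (`B (S φ) = φ`) and `z` solves
the ADJOINT problem `B† z = ℓ`, i.e. `B u z = ℓ u` for all `u`, then `ℓ (S φ) = φ z` for every `φ ∈ E*`
(so the coefficient functionals of a finite-rank correction are evaluations at the adjoint solves).
[cite: Kato1966, III-§4.3, (4.13) (degenerate perturbations: the functionals `(·, e_k)`)] -/
theorem apply_inverse_eq_of_adjoint {B : E →L[ℝ] E →L[ℝ] ℝ} (S : StrongDual ℝ E →L[ℝ] E)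
    (hBS : ∀ φ, B (S φ) = φ) {ℓ : E →L[ℝ] ℝ} {z : E} (hz : ∀ u, B u z = ℓ u)
    (φ : StrongDual ℝ E) : ℓ (S φ) = φ z := by
  rw [← hz (S φ), hBS]

omit [CompleteSpace E] in
/-- The adjoint form `B† u w := B w u` is coercive with the same constant (so (C1) also inverts the adjoint
problems and encloses the adjoint solves). [cite: Brezis2011, Cor. 5.8 (Lax–Milgram)] -/
theorem coercive_flip {B : E →L[ℝ] E →L[ℝ] ℝ} {c : ℝ} (hB : ∀ u, c * ‖u‖ ^ 2 ≤ B u u) (u : E) :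
    c * ‖u‖ ^ 2 ≤ B.flip u u := by
  rw [ContinuousLinearMap.flip_apply]
  exact hB u

/-- In the dual, evaluation at `z` is the inner product with the Riesz representative:
`φ z = ⟪z, (toDual ℝ E)⁻¹ φ⟫` and `‖(toDual ℝ E)⁻¹ φ‖ = ‖φ‖`. [cite: Brezis2011, Thm. 5.5 (Riesz–Fréchet)] -/
theorem dual_apply_eq_inner_toDual_symm (φ : StrongDual ℝ E) (z : E) :
    φ z = inner ℝ z ((InnerProductSpace.toDual ℝ E).symm φ) ∧
      ‖(InnerProductSpace.toDual ℝ E).symm φ‖ = ‖φ‖ := by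
  refine ⟨?_, LinearIsometryEquiv.norm_map _ _⟩
  rw [real_inner_comm, InnerProductSpace.toDual_symm_apply]

end Coercive

/-! ### (C2) The finite-rank correction: explicit two-sided inverse and its product-free norm bound -/

section FiniteRank

variable {E F : Type*} [NormedAddCommGroup E] [NormedSpace ℝ E] [NormedAddCommGroup F] [NormedSpace ℝ F]
variable {ι : Type*} [Fintype ι] [DecidableEq ι]

omit [DecidableEq ι] in
/-- The operator `D_N = (1 − finiteRank f (ℓ ∘ S)) ∘ B` acts as `u ↦ B u − ∑ᵢ ℓᵢ(u) fᵢ` when `S B = 1`.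
[cite: Kato1966, III-§4.3, (4.7)] -/
theorem finiteRankPerturbation_apply (B : E →L[ℝ] F) (S : F →L[ℝ] E) (hSB : ∀ u, S (B u) = u)
    (f : ι → F) (ℓ : ι → E →L[ℝ] ℝ) (u : E) :
    ((1 - finiteRank f (fun i => (ℓ i).comp S)).comp B) u = B u - ∑ i, ℓ i u • f i := by
  simp [hSB]

omit [DecidableEq ι] in
/-- The candidate inverse `T_N = S ∘ capInverse` acts as `y ↦ S y + ∑ᵢ (N x)ᵢ (S fᵢ)`, `xⱼ = ℓⱼ(S y)` — the
Woodbury formula "`D_N⁻¹ = S + 𝕍 C⁻¹ ℒ S`" with `vᵢ = S fᵢ` the forward solves.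
[cite: Kato1966, III-§4.3, (4.13)] -/
theorem inverse_comp_capInverse_apply (S : F →L[ℝ] E) (f : ι → F) (ℓ : ι → E →L[ℝ] ℝ)
    (N : Matrix ι ι ℝ) (y : F) :
    (S.comp (capInverse f (fun i => (ℓ i).comp S) N)) y =
      S y + ∑ i, (N *ᵥ fun j => ℓ j (S y)) i • S (f i) := by
  rw [ContinuousLinearMap.comp_apply, capInverse_apply, map_add, map_sum]
  simp only [ContinuousLinearMap.comp_apply, map_smul]

omit [Fintype ι] [DecidableEq ι] in
/-- The capacitance matrix of `D_N` is `ℓⱼ(vᵢ)` with `vᵢ = S fᵢ` (computable from the forward solves).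
[cite: Kato1966, III-§4.3, (4.13)] -/
theorem capMatrix_comp_inverse_apply (S : F →L[ℝ] E) (f : ι → F) (ℓ : ι → E →L[ℝ] ℝ) (j i : ι) :
    capMatrix f (fun i => (ℓ i).comp S) j i = ℓ j (S (f i)) := rfl

/-- **Two-sided inverse of the finite-rank perturbation (Sherman–Morrison–Woodbury).**  If `S` is a two-sided
inverse of `B : E → F` and `N` a two-sided inverse of `1 − capMatrix` (`capMatrix j i = ℓⱼ(S fᵢ)`), then
`T_N := S ∘ capInverse f (ℓ ∘ S) N` is a two-sided inverse of `D_N := (1 − finiteRank f (ℓ ∘ S)) ∘ B`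
(`D_N u = B u − ∑ ℓᵢ(u) fᵢ`). [cite: Kato1966, III-§4.3, (4.13); IV-§1.4, Thm. 1.16] -/
theorem finiteRankPerturbation_inverse (B : E →L[ℝ] F) (S : F →L[ℝ] E) (hBS : ∀ y, B (S y) = y)
    (hSB : ∀ u, S (B u) = u) (f : ι → F) (ℓ : ι → E →L[ℝ] ℝ) (N : Matrix ι ι ℝ)
    (hN₁ : (1 - capMatrix f (fun i => (ℓ i).comp S)) * N = 1)
    (hN₂ : N * (1 - capMatrix f (fun i => (ℓ i).comp S)) = 1) :
    (∀ y, ((1 - finiteRank f (fun i => (ℓ i).comp S)).comp B)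
        ((S.comp (capInverse f (fun i => (ℓ i).comp S) N)) y) = y) ∧
    (∀ u, (S.comp (capInverse f (fun i => (ℓ i).comp S) N))
        (((1 - finiteRank f (fun i => (ℓ i).comp S)).comp B) u) = u) := by
  set g : ι → F →L[ℝ] ℝ := fun i => (ℓ i).comp S with hg
  constructor
  · intro y
    have h := congrArg (fun T : F →L[ℝ] F => T y) (one_sub_finiteRank_comp_capInverse f g N hN₁)
    have h' : (1 - finiteRank f g) (capInverse f g N y) = y := by simpa using h
    rw [ContinuousLinearMap.comp_apply, ContinuousLinearMap.comp_apply, hBS]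
    exact h'
  · intro u
    have h := congrArg (fun T : F →L[ℝ] F => T (B u)) (capInverse_comp_one_sub_finiteRank f g N hN₂)
    have h' : capInverse f g N ((1 - finiteRank f g) (B u)) = B u := by simpa using h
    rw [ContinuousLinearMap.comp_apply, ContinuousLinearMap.comp_apply, h', hSB]

omit [DecidableEq ι] in
/-- **Product-free bound for `T_N` (pivot-space form).**  Suppose `‖S y‖ ≤ K₁‖u‖` and the coefficient
functionals of the correction are inner products in a real inner product space `W`: `ℓⱼ(S y) = ⟪aⱼ, u⟫` for a
family `a : ι → W` and some `u ∈ W` attached to `y` (e.g. `y = J u`).  If the Gram pencil of `a` bounds the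
correction, `‖∑ᵢ (N G_a w)ᵢ S fᵢ‖² ≤ Λ wᵀ G_a w` for all `w`, then `‖T_N y‖ ≤ (K₁ + √Λ)‖u‖`.
[cite: Kato1966, I-§6.3 with III-§4.3 (4.13)] -/
theorem norm_inverse_add_correction_le {W : Type*} [NormedAddCommGroup W] [InnerProductSpace ℝ W]
    (S : F →L[ℝ] E) (f : ι → F) (ℓ : ι → E →L[ℝ] ℝ) (N : Matrix ι ι ℝ) (a : ι → W) {K₁ Λ : ℝ}
    (hΛ : 0 ≤ Λ)
    (hpencil : ∀ w : ι → ℝ, ‖∑ i, (N *ᵥ (Matrix.gram ℝ a *ᵥ w)) i • S (f i)‖ ^ 2 ≤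
      Λ * (w ⬝ᵥ (Matrix.gram ℝ a *ᵥ w)))
    (y : F) (u : W) (hy : ‖S y‖ ≤ K₁ * ‖u‖) (hx : ∀ j, ℓ j (S y) = inner ℝ (a j) u) :
    ‖S y + ∑ i, (N *ᵥ fun j => ℓ j (S y)) i • S (f i)‖ ≤ (K₁ + Real.sqrt Λ) * ‖u‖ := by
  have hcorr := norm_sum_mulVec_smul_le_of_gram_pencil a (fun i => S (f i)) N hΛ hpencil u
    (fun j => ℓ j (S y)) hx
  calc ‖S y + ∑ i, (N *ᵥ fun j => ℓ j (S y)) i • S (f i)‖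
      ≤ ‖S y‖ + ‖∑ i, (N *ᵥ fun j => ℓ j (S y)) i • S (f i)‖ := norm_add_le _ _
    _ ≤ K₁ * ‖u‖ + Real.sqrt Λ * ‖u‖ := add_le_add hy hcorr
    _ = (K₁ + Real.sqrt Λ) * ‖u‖ := by ring

end FiniteRank

section FiniteRankDual

variable {E : Type*} [NormedAddCommGroup E] [InnerProductSpace ℝ E] [CompleteSpace E]
variable {ι : Type*} [Fintype ι]

/-- **Product-free bound for `T_N : E* → E` (dual form).**  With `S : E* → E` a right inverse of the
form-operator `B` (`B (S φ) = φ`) with `‖S φ‖ ≤ K₁‖φ‖`, adjoint solves `zⱼ` (`B u zⱼ = ℓⱼ u` for all `u`),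
and the Gram pencil of the `zⱼ` (in `E`) bounding the correction by `Λ`:
`‖S φ + ∑ᵢ (N x)ᵢ S fᵢ‖ ≤ (K₁ + √Λ)‖φ‖`, `xⱼ = ℓⱼ(S φ)`, for every `φ ∈ E*`.
[cite: Kato1966, I-§6.3 with III-§4.3 (4.13)] -/
theorem norm_inverse_add_correction_le_dual {B : E →L[ℝ] E →L[ℝ] ℝ} (S : StrongDual ℝ E →L[ℝ] E)
    (hBS : ∀ φ, B (S φ) = φ) {K₁ : ℝ} (hS : ∀ φ, ‖S φ‖ ≤ K₁ * ‖φ‖)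
    (f : ι → StrongDual ℝ E) (ℓ : ι → E →L[ℝ] ℝ) (z : ι → E) (hz : ∀ j u, B u (z j) = ℓ j u)
    (N : Matrix ι ι ℝ) {Λ : ℝ} (hΛ : 0 ≤ Λ)
    (hpencil : ∀ w : ι → ℝ, ‖∑ i, (N *ᵥ (Matrix.gram ℝ z *ᵥ w)) i • S (f i)‖ ^ 2 ≤
      Λ * (w ⬝ᵥ (Matrix.gram ℝ z *ᵥ w)))
    (φ : StrongDual ℝ E) :
    ‖S φ + ∑ i, (N *ᵥ fun j => ℓ j (S φ)) i • S (f i)‖ ≤ (K₁ + Real.sqrt Λ) * ‖φ‖ := by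
  set u : E := (InnerProductSpace.toDual ℝ E).symm φ with hu
  have hnorm : ‖u‖ = ‖φ‖ := (dual_apply_eq_inner_toDual_symm φ (0 : E)).2
  rw [← hnorm]
  refine norm_inverse_add_correction_le S f ℓ N z hΛ hpencil φ u (by rw [hnorm]; exact hS φ) ?_
  intro j
  rw [apply_inverse_eq_of_adjoint S hBS (hz j) φ]
  exact (dual_apply_eq_inner_toDual_symm φ (z j)).1

end FiniteRankDual

/-! ### (C3) The small remainder in a weaker norm: two-norm Neumann step -/

section TwoNorm

variable {E F W : Type*} [NormedAddCommGroup E] [NormedSpace ℝ E] [CompleteSpace E]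
  [NormedAddCommGroup F] [NormedSpace ℝ F] [NormedAddCommGroup W] [NormedSpace ℝ W]

/-- `‖(1 − t)⁻¹‖ ≤ (1 − ‖t‖)⁻¹` for `‖t‖ < 1` in `E →L E` (geometric series; `‖1‖ ≤ 1`). [folklore] -/
private theorem norm_oneSub_inv_le' {t : E →L[ℝ] E} (ht : ‖t‖ < 1) :
    ‖(↑(Units.oneSub t ht)⁻¹ : E →L[ℝ] E)‖ ≤ (1 - ‖t‖)⁻¹ := by
  have h1 : (↑(Units.oneSub t ht)⁻¹ : E →L[ℝ] E) = ∑' n : ℕ, t ^ n := rfl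
  rw [h1]
  have h2 := tsum_geometric_le_of_norm_lt_one t ht
  have h3 : ‖(1 : E →L[ℝ] E)‖ ≤ 1 := by
    rw [ContinuousLinearMap.one_def]
    exact ContinuousLinearMap.norm_id_le
  linarith

/-- **Two-norm Neumann step.**  Let `D : E → F` have the two-sided inverse `T` with `‖T y‖ ≤ K⋆‖y‖` for all
`y ∈ F` and the better bound `‖T (J g)‖ ≤ K_w‖g‖` on the range of `J : W → F`; let `R : E → W` have
`‖R u‖ ≤ ε‖u‖` with `K_w ε < 1` (`K_w, ε ≥ 0`).  Then `D − J ∘ R` has a two-sided bounded inverse `T'` with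
`‖T' y‖ ≤ K⋆/(1 − K_w ε) · ‖y‖`.  (Banach lemma in `E` for `M = T J R`, `‖M‖ ≤ K_w ε`:
`D − J R = D (1 − M)`, `T' = (1 − M)⁻¹ T`.) [cite: Kato1966, IV-§1.4, Thm. 1.16] -/
theorem exists_inverse_sub_of_two_norm (D : E →L[ℝ] F) (T : F →L[ℝ] E) (hDT : ∀ y, D (T y) = y)
    (hTD : ∀ u, T (D u) = u) (J : W →L[ℝ] F) (R : E →L[ℝ] W) {Ks Kw ε : ℝ}
    (hKs : ∀ y, ‖T y‖ ≤ Ks * ‖y‖) (hKw : ∀ g, ‖T (J g)‖ ≤ Kw * ‖g‖) (hR : ∀ u, ‖R u‖ ≤ ε * ‖u‖)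
    (hKw0 : 0 ≤ Kw) (hε0 : 0 ≤ ε) (h1 : Kw * ε < 1) :
    ∃ T' : F →L[ℝ] E, (∀ y, (D - J.comp R) (T' y) = y) ∧ (∀ u, T' ((D - J.comp R) u) = u) ∧
      ∀ y, ‖T' y‖ ≤ Ks / (1 - Kw * ε) * ‖y‖ := by
  set M : E →L[ℝ] E := T.comp (J.comp R) with hM
  have hMle : ‖M‖ ≤ Kw * ε := by
    refine ContinuousLinearMap.opNorm_le_bound _ (mul_nonneg hKw0 hε0) fun u => ?_
    calc ‖M u‖ = ‖T (J (R u))‖ := rfl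
      _ ≤ Kw * ‖R u‖ := hKw _
      _ ≤ Kw * (ε * ‖u‖) := mul_le_mul_of_nonneg_left (hR u) hKw0
      _ = Kw * ε * ‖u‖ := by ring
  have hM1 : ‖M‖ < 1 := lt_of_le_of_lt hMle h1
  set U : (E →L[ℝ] E)ˣ := Units.oneSub M hM1 with hU
  have hUval : ∀ v, (U : E →L[ℝ] E) v = v - M v := fun v => by
    simp [hU, Units.oneSub]
  have hUinv : ∀ v, (U : E →L[ℝ] E) ((↑U⁻¹ : E →L[ℝ] E) v) = v := fun v => by
    rw [← ContinuousLinearMap.comp_apply, ← ContinuousLinearMap.mul_def, Units.mul_inv]; rfl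
  have hinvU : ∀ v, (↑U⁻¹ : E →L[ℝ] E) ((U : E →L[ℝ] E) v) = v := fun v => by
    rw [← ContinuousLinearMap.comp_apply, ← ContinuousLinearMap.mul_def, Units.inv_mul]; rfl
  -- the factorisation `(D − J R) v = D (U v)`
  have hfac : ∀ v, (D - J.comp R) v = D ((U : E →L[ℝ] E) v) := by
    intro v
    rw [hUval, map_sub, show (D - J.comp R) v = D v - J (R v) from rfl, hM]
    simp only [ContinuousLinearMap.comp_apply, hDT]
  refine ⟨(↑U⁻¹ : E →L[ℝ] E).comp T, fun y => ?_, fun u => ?_, fun y => ?_⟩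
  · rw [hfac, ContinuousLinearMap.comp_apply, hUinv, hDT]
  · rw [ContinuousLinearMap.comp_apply, hfac, hTD, hinvU]
  · have hpos : 0 < 1 - Kw * ε := by linarith
    have hpos' : 0 < 1 - ‖M‖ := by linarith
    have hKs0 : 0 ≤ Ks * ‖y‖ := (norm_nonneg _).trans (hKs y)
    calc ‖((↑U⁻¹ : E →L[ℝ] E).comp T) y‖ = ‖(↑U⁻¹ : E →L[ℝ] E) (T y)‖ := rfl
      _ ≤ ‖(↑U⁻¹ : E →L[ℝ] E)‖ * ‖T y‖ := ContinuousLinearMap.le_opNorm _ _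
      _ ≤ (1 - ‖M‖)⁻¹ * (Ks * ‖y‖) :=
          mul_le_mul (norm_oneSub_inv_le' hM1) (hKs y) (norm_nonneg _) (inv_nonneg.2 hpos'.le)
      _ ≤ (1 - Kw * ε)⁻¹ * (Ks * ‖y‖) := by
          refine mul_le_mul_of_nonneg_right ?_ hKs0
          exact inv_anti₀ hpos (by linarith)
      _ = Ks / (1 - Kw * ε) * ‖y‖ := by ring

end TwoNorm

end Literature.Analysis.OperatorTheory

end
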